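import Literature.RepresentationTheory.FiniteGroups.PermutationLatticeReduction
import Literature.RepresentationTheory.FiniteGroups.StableLatticeReductionHom
import HarnessLib

/-!
# Reductions mod `p` of permutation lattices: pull-back along a group isomorphism

Topic `RepresentationTheory/FiniteGroups`; namespace `Literature.RepresentationTheory.FiniteGroups`
(sub-namespace `PermutationLattice`).  THEOREMS ONLY (no definition, no named fact, no `sorry`, no
instance).  Companion of `PermutationLatticeReduction` / `PermutationReductionFreeAction`, for an additive
invariant `ψ` of finite `p`-torsion `ℤ[Δ]`-modules (B3a-β binder pair; the instance binders of `ψ` are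
written strict-implicit — the same Π-type, cf. `AdditiveInvariantExactPieces`).

* pull-back along an isomorphism `e : Δ ≃* G`: `ψ((ℤ[G] ∘ e)/p) = ψ(ℤ[Δ]/p)` for the regular
  permutation modules (`additive_reduction_regular_comp_mulEquiv`, transport along `mapDomain e⁻¹`) and
  `ψ((𝟙_G ∘ e)/p) = ψ(𝟙_Δ/p)` (`additive_reduction_trivial_comp`).

Lane «TATE-EPC-TC» of cell `bsd-eis` (crux `GoodLatticeBDPValue`, stmt-BirchSwinnertonDyer-19032), brick
B8-arith ≡ B6b: the passage `Gal(E/F₀) ≃ ↥U ⧸ Gal(K_S/E)` (`layerEquiv`) for the regular term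
`r₂(F₀)·[𝔽_p[Gal(E/F₀)]]` and the unit term of Tate's computation.  HONEST FRAMING: finite-group
bookkeeping only.

## References
* J.-P. Serre, *Représentations linéaires des groupes finis* (1977), §15.2 Thm. 32.
  [SerreLinearRepresentations1977]
-/

namespace Literature.RepresentationTheory.FiniteGroups

namespace PermutationLattice

open Function Submodule MonoidAlgebra StableLatticeReduction
open _root_.Representation
open scoped Pointwise

/-! ## §2 Pull-back of the regular and the trivial permutation module along `e : Δ ≃* G` -/

section Pullback

variable {Δ G : Type} [Group Δ] [Group G] {A : Type*} [AddCommGroup A] {p : ℕ}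

variable (ψ : ∀ ⦃Y : Type⦄ ⦃_ : AddCommGroup Y⦄ ⦃_ : Module ℤ Y⦄, Representation ℤ Δ Y → A)
  (hψ : ∀ ⦃X Y Z : Type⦄ [AddCommGroup X] [Module ℤ X] [AddCommGroup Y] [Module ℤ Y]
    [AddCommGroup Z] [Module ℤ Z] (ρX : Representation ℤ Δ X) (ρY : Representation ℤ Δ Y)
    (ρZ : Representation ℤ Δ Z) (f : X →ₗ[ℤ] Y) (g : Y →ₗ[ℤ] Z),
    (∀ s x, f (ρX s x) = ρY s (f x)) → (∀ s y, g (ρY s y) = ρZ s (g y)) →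
    Injective f → Surjective g → LinearMap.range f = LinearMap.ker g → Finite Y →
    (∀ y : Y, (p : ℤ) • y = 0) → ψ ρY = ψ ρX + ψ ρZ)
include hψ

/-- **The regular permutation module pulls back to the regular permutation module**: for a group
isomorphism `e : Δ ≃* G`, `ψ((ℤ[G] ∘ e)/p) = ψ(ℤ[Δ]/p)` (transport along `mapDomain e⁻¹ : ℤ[G] ≃ ℤ[Δ]`,
which intertwines left translation by `e d` with left translation by `d`).
[cite: SerreLinearRepresentations1977, §15.2 Thm. 32] -/
theorem additive_reduction_regular_comp_mulEquiv [Finite Δ] [hp : Fact p.Prime] (e : Δ ≃* G) :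
    ψ (Representation.quotient ((Representation.ofMulAction ℤ G G).comp e.toMonoidHom) ((p : ℤ) • ⊤)
        (smul_top_le_comap _ (p : ℤ))) =
      ψ ((Representation.ofMulAction ℤ Δ Δ).quotient ((p : ℤ) • ⊤) (smul_top_le_comap _ (p : ℤ))) := by
  classical
  haveI : Fintype Δ := Fintype.ofFinite Δ
  haveI := finite_monoidAlgebra_quotient_smul_top (p := p) Δ
  refine Int.additive_reduction_eq_of_linearEquiv ψ hψ _ _
    (MonoidAlgebra.mapDomainLinearEquiv ℤ ℤ e.symm.toEquiv) (fun d f => ?_)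
  change MonoidAlgebra.mapDomainLinearEquiv ℤ ℤ e.symm.toEquiv
      (Representation.ofMulAction ℤ G G (e d) f) = _
  induction f using MonoidAlgebra.induction_linear with
  | zero => simp only [map_zero]
  | add f g hf hg => simp only [map_add, hf, hg]
  | single x r =>
    rw [Representation.ofMulAction_single, mapDomainLinearEquiv_single, mapDomainLinearEquiv_single,
      Representation.ofMulAction_single, smul_eq_mul, smul_eq_mul]
    change single (e.symm (e d * x)) r = single (d * e.symm x) r
    rw [map_mul, MulEquiv.symm_apply_apply]

/-- **The unit representation pulls back to the unit representation**: `ψ((𝟙_G ∘ e)/p) = ψ(𝟙_Δ/p)`.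
[cite: SerreLinearRepresentations1977, §15.2 Thm. 32] -/
theorem additive_reduction_trivial_comp [hp : Fact p.Prime] (e : Δ →* G) :
    ψ (Representation.quotient ((Representation.trivial ℤ G ℤ).comp e) ((p : ℤ) • ⊤)
        (smul_top_le_comap _ (p : ℤ))) =
      ψ ((Representation.trivial ℤ Δ ℤ).quotient ((p : ℤ) • ⊤) (smul_top_le_comap _ (p : ℤ))) := by
  haveI : Finite (ℤ ⧸ ((p : ℤ) • ⊤ : Submodule ℤ ℤ)) :=
    Int.finite_quotient_smul_top (by exact_mod_cast hp.out.ne_zero)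
  exact Int.additive_reduction_eq_of_linearEquiv ψ hψ _ _ (LinearEquiv.refl ℤ ℤ) (fun d x => rfl)

end Pullback

end PermutationLattice

end Literature.RepresentationTheory.FiniteGroups
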